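import Mathlib
import Summits.HodgeConjecture.FermatCycles.HodgeFermatLemmaEGoodB
import Summits.HodgeConjecture.FermatCycles.HodgeFermatHypVDefs

/-!
# The Bad coefficients vanish — part 2: counting characters; the exceptional sets `oddK`, `cosetC` (`HodgeFermat/BadVanish.lean`; HF-G33)

Tree copy (part 2 of 4) of the module `HodgeFermat/BadVanish.lean` of the sibling cell's standalone package
`run/shared/lean/pub/pub-hodgefermat/lean/HodgeFermat/` (996 lines, sha256 `0bc1ccd5eb68b6bb…`), source lines 250–466 (§3 counting characters: annihilators, cosets, parity; §4 the exceptional sets `oddK N q`, `cosetC N q` and their cardinalities `≤ tauV N q`).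
Filed by cell `pub-hfermat`, seat prover-1 gen-2, on the COORDINATOR KEEPER RULING of 2026-08-25 (gem sweep H1: take the
off-gate kernel theorem `thmFstar` through the gate) — here its second namesake, `HodgeFermat/ThmFstarNFinal.lean:29`,
THEOREM F*(3N) at every admissible squarefree level (the first, `DecodingFinal.thmFstar` = THEOREM F* at the prime levels,
landed on 2026-08-25 as `HodgeFermatThmFstar.lean`, seat prover-1 gen-0); this file is one link of the import closure of
`ThmFstarNFinal.thmFstar` on top of that landed chain.  The source module's declarations are VERBATIM those of the cell record
`check/ThmFstarN_standalone.lean` (21 bodies, 438 871 B, sha256 ced731ec52c92191…, hub `lean check` rc 0, 222.2 s, `--axioms …ThmFstarN.thmFstarN` = [propext, Classical.choice, Quot.sound]; pub-hodgefermat `CERT.md` l.987, GATE HF-G33).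
Deviations from the source module, exhaustively: the `import` lines (tree modules `Summits.HodgeConjecture.FermatCycles.
HodgeFermat*` instead of `HodgeFermat.*`); this module docstring; this part imports `HodgeFermatLemmaEGoodB`/`HodgeFermatHypVDefs` directly, not part 1 (§§3–4 use nothing of §§1–2; parts 1 and 2–3 land in parallel, part 4 imports both); the `set_option`/namespace/`open` preamble (source l.37–48) is repeated at the top because the module is split; one-line docstrings added (gate lint) to `forall_zpowers_iff`, `two_mul_card_oddK_le`, `card_cosetC_le`. The module docstring is quoted in full in part 1.
Every other line — in particular every declaration's statement and proof — is byte-identical to the source.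
HONEST FRAMING: explicit algebraic cycles for specific Hodge classes on Fermat/Delsarte varieties; residual open instances
listed; no claim on general Hodge.  (This file is arithmetic of CM types / of `(ℤ/N)ˣ`; it claims nothing about cycles.)
-/

set_option autoImplicit false

namespace HodgeFermat.KRFree.BadVanish

open Finset HodgeFermat.KRFree.LemmaN HodgeFermat.KRFree.TwistedMoment HodgeFermat.KRFree.LemmaEMu
open HodgeFermat.KRFree.LemmaEGood
open HodgeFermat.KRFree.ChiThree (chi3 chi3_mul_self)
open HodgeFermat.KRFree.NuChar (chi3Mul chi3Mul_natCast)
open HodgeFermat.KRFree.MuEven (muEntry muFun)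
open HodgeFermat.KRFree.NuOdd (nuEntry nuFun nuEntry_eq_zero)
open HodgeFermat.KRFree.HypVDefs (tauV IneqV)
open DirichletCharacter (changeLevel annihilator subgroupOfPrimitiveMapToOne)
/-! ## 3. Counting characters: annihilators, cosets, parity (cf. `HypBReduction.lean` §5) -/

section counting

variable {M : ℕ} [NeZero M]

omit [NeZero M] in
/-- a character is trivial on the cyclic subgroup generated by `u` iff it is `1` at `u` -/
lemma forall_zpowers_iff (χ : DirichletCharacter ℂ M) (u : (ZMod M)ˣ) :
    (∀ m ∈ Subgroup.zpowers u, χ (m : ZMod M) = 1) ↔ χ (u : ZMod M) = 1 := by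
  constructor
  · intro h
    exact h u (Subgroup.mem_zpowers u)
  · intro h m hm
    have hker : Subgroup.zpowers u ≤ (MulChar.toUnitHom χ).ker := by
      rw [Subgroup.zpowers_le, MonoidHom.mem_ker, ← Units.val_eq_one, MulChar.coe_toUnitHom]
      exact h
    have h2 := hker hm
    rw [MonoidHom.mem_ker, ← Units.val_eq_one, MulChar.coe_toUnitHom] at h2
    exact h2

/-- `#Ann(u) · ord(u) = φ(M)`: the characters mod `M` trivial at a unit `u`. -/
theorem card_annihilator_mul_orderOf (u : (ZMod M)ˣ) :
    Nat.card (annihilator ℂ ({u} : Set (ZMod M)ˣ)) * orderOf u = M.totient := by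
  have hA : annihilator ℂ ({u} : Set (ZMod M)ˣ)
      = (MulChar.subgroupOrderIsoSubgroupMulChar (ZMod M) ℂ (Subgroup.zpowers u)).ofDual := by
    ext χ
    rw [DirichletCharacter.mem_annihilator_iff, MulChar.mem_subgroupOrderIsoSubgroupMulChar_iff]
    simp only [Set.mem_singleton_iff, forall_eq]
    exact (forall_zpowers_iff χ u).symm
  rw [hA, MulChar.card_subgroupOrderIsoSubgroupMulChar, ← Nat.card_zpowers,
    ← Subgroup.card_eq_card_quotient_mul_card_subgroup, Nat.card_eq_fintype_card,
    ZMod.card_units_eq_totient]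

omit [NeZero M] in
open Classical in
/-- the characters with a PRESCRIBED value at a unit form an empty set or a coset of the annihilator -/
theorem card_filter_apply_eq_le (u : (ZMod M)ˣ) (c : ℂ) :
    (Finset.univ.filter (fun θ : DirichletCharacter ℂ M => θ (u : ZMod M) = c)).card
      ≤ Nat.card (annihilator ℂ ({u} : Set (ZMod M)ˣ)) := by
  set S := Finset.univ.filter (fun θ : DirichletCharacter ℂ M => θ (u : ZMod M) = c) with hS
  set Af := Finset.univ.filter (fun θ : DirichletCharacter ℂ M => θ ∈ annihilator ℂ ({u} : Set (ZMod M)ˣ))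
    with hAf
  have hcardA : Nat.card (annihilator ℂ ({u} : Set (ZMod M)ˣ)) = Af.card := by
    rw [← Nat.card_eq_finsetCard]
    exact Nat.card_congr (Equiv.subtypeEquivRight (fun χ => by simp [hAf]))
  rw [hcardA]
  by_cases hne : S.Nonempty
  · obtain ⟨θ₁, hθ₁⟩ := hne
    rw [hS, Finset.mem_filter] at hθ₁
    refine Finset.card_le_card_of_injOn (fun θ => θ * θ₁⁻¹) ?_ ?_
    · intro θ hθ
      rw [Finset.mem_coe, hS, Finset.mem_filter] at hθ
      rw [Finset.mem_coe, hAf, Finset.mem_filter]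
      refine ⟨Finset.mem_univ _, ?_⟩
      rw [DirichletCharacter.mem_annihilator_iff]
      simp only [Set.mem_singleton_iff, forall_eq]
      have h1 : (θ₁ * θ₁⁻¹) (u : ZMod M) = 1 := by
        rw [mul_inv_cancel, MulChar.one_apply_coe]
      rw [MulChar.mul_apply] at h1
      rw [MulChar.mul_apply, hθ.2, ← hθ₁.2, h1]
    · intro a _ b _ h
      exact mul_right_cancel h
  · rw [Finset.not_nonempty_iff_eq_empty] at hne
    rw [hne, Finset.card_empty]
    exact Nat.zero_le _

open Classical in
/-- In any subgroup of characters, at most half of the elements are odd. -/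
theorem two_mul_card_odd_le {L : ℕ} [NeZero L] (B : Subgroup (DirichletCharacter ℂ L)) :
    2 * (Finset.univ.filter (fun χ : DirichletCharacter ℂ L => χ ∈ B ∧ χ.Odd)).card ≤ Nat.card B := by
  set Bf := Finset.univ.filter (fun χ : DirichletCharacter ℂ L => χ ∈ B) with hBf
  set O := Finset.univ.filter (fun χ : DirichletCharacter ℂ L => χ ∈ B ∧ χ.Odd) with hO
  set E := Finset.univ.filter (fun χ : DirichletCharacter ℂ L => χ ∈ B ∧ χ.Even) with hE
  have hcardB : Nat.card B = Bf.card := by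
    rw [← Nat.card_eq_finsetCard]
    exact Nat.card_congr (Equiv.subtypeEquivRight (fun χ => by simp [hBf]))
  have hOE : Disjoint O E := by
    rw [Finset.disjoint_left]
    intro χ h1 h2
    rw [hO, Finset.mem_filter] at h1
    rw [hE, Finset.mem_filter] at h2
    exact DirichletCharacter.not_even_and_odd χ ⟨h2.2.2, h1.2.2⟩
  have hsub : O ∪ E ⊆ Bf := by
    intro χ hχ
    rw [hBf, Finset.mem_filter]
    rcases Finset.mem_union.mp hχ with h | h
    · rw [hO, Finset.mem_filter] at h
      exact ⟨Finset.mem_univ _, h.2.1⟩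
    · rw [hE, Finset.mem_filter] at h
      exact ⟨Finset.mem_univ _, h.2.1⟩
  have hOEB : O.card + E.card ≤ Bf.card := by
    rw [← Finset.card_union_of_disjoint hOE]
    exact Finset.card_le_card hsub
  by_cases hne : O.Nonempty
  · obtain ⟨χ₁, hχ₁⟩ := hne
    rw [hO, Finset.mem_filter] at hχ₁
    have hmap : O.card ≤ E.card := by
      refine Finset.card_le_card_of_injOn (fun χ => χ * χ₁) ?_ ?_
      · intro χ hχ
        rw [Finset.mem_coe, hO, Finset.mem_filter] at hχ
        rw [Finset.mem_coe, hE, Finset.mem_filter]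
        refine ⟨Finset.mem_univ _, B.mul_mem hχ.2.1 hχ₁.2.1, ?_⟩
        show (χ * χ₁) (-1) = 1
        rw [MulChar.mul_apply, hχ.2.2, hχ₁.2.2]
        norm_num
      · intro a _ b _ h
        exact mul_right_cancel h
    omega
  · rw [Finset.not_nonempty_iff_eq_empty] at hne
    rw [hne, Finset.card_empty]
    omega

variable (n p : ℕ) [NeZero n] [Fact p.Prime]

/-- `#K_p · ord_{N'}(p) = φ(N')` with `N' = n / p ^ v_p(n)` (`K_p` = Mathlib's `subgroupOfPrimitiveMapToOne`). -/
theorem card_K_mul_orderOf :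
    Nat.card (subgroupOfPrimitiveMapToOne ℂ n p) * orderOf ((p : ℕ) : ZMod (n / p ^ n.factorization p))
      = (n / p ^ n.factorization p).totient := by
  haveI : NeZero (n / p ^ n.factorization p) := ⟨(Nat.ordCompl_pos p (NeZero.ne n)).ne'⟩
  rw [subgroupOfPrimitiveMapToOne, Subgroup.card_map_of_injective (DirichletCharacter.changeLevel_injective _),
    ← ZMod.coe_unitOfCoprime p (Nat.coprime_ordCompl Fact.out (NeZero.ne n)), orderOf_units]
  exact card_annihilator_mul_orderOf _

end counting

/-! ## 4. The exceptional sets `oddK N q` (μ) and `cosetC N q` (ν) and their cardinalities `≤ tauV N q` -/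

section sets

variable {N : ℕ} [NeZero N]

/-- arithmetic of a prime `q` of a squarefree `N` -/
lemma sqf_facts (hsq : Squarefree N) {q : ℕ} (hq : q ∈ N.primeFactors) :
    q.Prime ∧ q ∣ N ∧ N.factorization q = 1 ∧ Nat.Coprime q (N / q) ∧ 0 < N / q := by
  have hqq : q.Prime := Nat.prime_of_mem_primeFactors hq
  have hqN : q ∣ N := Nat.dvd_of_mem_primeFactors hq
  have hfac : N.factorization q = 1 := by
    have h1 := (Nat.squarefree_iff_factorization_le_one (NeZero.ne N)).mp hsq q
    have h2 := hqq.factorization_pos_of_dvd (NeZero.ne N) hqN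
    omega
  have hcop : q.Coprime (N / q) := by
    have := Nat.coprime_ordCompl hqq (NeZero.ne N)
    rwa [hfac, pow_one] at this
  exact ⟨hqq, hqN, hfac, hcop, Nat.div_pos (Nat.le_of_dvd (NeZero.pos N) hqN) hqq.pos⟩

/-- `tauV N q` is the order of the annihilator of `q` among the characters mod `N/q` -/
lemma card_annihilator_eq_tauV (hsq : Squarefree N) {q : ℕ} (hq : q ∈ N.primeFactors) :
    Nat.card (annihilator ℂ ({ZMod.unitOfCoprime q (sqf_facts hsq hq).2.2.2.1} : Set (ZMod (N / q))ˣ))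
      = tauV N q := by
  obtain ⟨hqq, hqN, hfac, hcop, hpos⟩ := sqf_facts hsq hq
  haveI : NeZero (N / q) := ⟨hpos.ne'⟩
  have h := card_annihilator_mul_orderOf (ZMod.unitOfCoprime q hcop)
  have hord : orderOf (ZMod.unitOfCoprime q hcop) = orderOf ((q : ℕ) : ZMod (N / q)) := by
    rw [← ZMod.coe_unitOfCoprime q hcop, orderOf_units]
  have hopos : 0 < orderOf ((q : ℕ) : ZMod (N / q)) := by
    rw [← hord]; exact orderOf_pos _
  unfold tauV
  rw [← h, hord, Nat.mul_div_cancel _ hopos]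

open Classical in
/-- the odd characters of `K_q` (empty if `q` is not prime) -/
noncomputable def oddK (N q : ℕ) [NeZero N] : Finset (DirichletCharacter ℂ N) :=
  if hq : q.Prime then
    Finset.univ.filter (fun χ => χ ∈ @subgroupOfPrimitiveMapToOne ℂ _ N _ q (Fact.mk hq) ∧ χ.Odd)
  else ∅

open Classical in
/-- `2 · #oddK N q ≤ tauV N q` (squarefree `N`, `q ∣ N` prime) -/
theorem two_mul_card_oddK_le (hsq : Squarefree N) {q : ℕ} (hq : q ∈ N.primeFactors) :
    2 * (oddK N q).card ≤ tauV N q := by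
  obtain ⟨hqq, hqN, hfac, hcop, hpos⟩ := sqf_facts hsq hq
  haveI := Fact.mk hqq
  haveI : NeZero (N / q) := ⟨hpos.ne'⟩
  have hN' : N / q ^ N.factorization q = N / q := by rw [hfac, pow_one]
  rw [oddK, dif_pos hqq]
  have hK := card_K_mul_orderOf N q
  rw [hN'] at hK
  have hle := two_mul_card_odd_le (@subgroupOfPrimitiveMapToOne ℂ _ N _ q (Fact.mk hqq))
  have hopos : 0 < orderOf ((q : ℕ) : ZMod (N / q)) := by
    rw [← ZMod.coe_unitOfCoprime q hcop, orderOf_units]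
    exact orderOf_pos _
  calc 2 * (Finset.univ.filter
        (fun χ => χ ∈ @subgroupOfPrimitiveMapToOne ℂ _ N _ q (Fact.mk hqq) ∧ χ.Odd)).card
      ≤ Nat.card (@subgroupOfPrimitiveMapToOne ℂ _ N _ q (Fact.mk hqq)) := hle
    _ = tauV N q := by
      unfold tauV
      rw [← hK, Nat.mul_div_cancel _ hopos]

open Classical in
/-- the characters mod `N` induced from a character mod `N/q` with the value `χ₃(q)` at `q` (empty unless `q ∣ N`) -/
noncomputable def cosetC (N q : ℕ) [NeZero N] : Finset (DirichletCharacter ℂ N) :=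
  if hq : q ∣ N then
    Finset.univ.filter (fun ψ => ∃ θ : DirichletCharacter ℂ (N / q),
      ψ = changeLevel (Nat.div_dvd_of_dvd hq) θ ∧ θ ((q : ℕ) : ZMod (N / q)) = (chi3 q : ℂ))
  else ∅

open Classical in
/-- `#cosetC N q ≤ tauV N q` (squarefree `N`, `q ∣ N` prime) -/
theorem card_cosetC_le (hsq : Squarefree N) {q : ℕ} (hq : q ∈ N.primeFactors) :
    (cosetC N q).card ≤ tauV N q := by
  obtain ⟨hqq, hqN, hfac, hcop, hpos⟩ := sqf_facts hsq hq
  haveI : NeZero (N / q) := ⟨hpos.ne'⟩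
  set S := Finset.univ.filter
    (fun θ : DirichletCharacter ℂ (N / q) => θ ((q : ℕ) : ZMod (N / q)) = (chi3 q : ℂ)) with hS
  have hsub : cosetC N q ⊆ S.image (changeLevel (Nat.div_dvd_of_dvd hqN)) := by
    intro ψ hψ
    rw [cosetC, dif_pos hqN, Finset.mem_filter] at hψ
    obtain ⟨θ, hψθ, hθ⟩ := hψ.2
    rw [Finset.mem_image]
    exact ⟨θ, by rw [hS, Finset.mem_filter]; exact ⟨Finset.mem_univ _, hθ⟩, hψθ.symm⟩
  have h1 : (cosetC N q).card ≤ S.card := (Finset.card_le_card hsub).trans Finset.card_image_le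
  have h2 : S.card ≤ Nat.card (annihilator ℂ ({ZMod.unitOfCoprime q hcop} : Set (ZMod (N / q))ˣ)) := by
    have := card_filter_apply_eq_le (ZMod.unitOfCoprime q hcop) (chi3 q : ℂ)
    rw [ZMod.coe_unitOfCoprime] at this
    exact this
  rw [← card_annihilator_eq_tauV hsq hq]
  exact h1.trans h2

end sets

end HodgeFermat.KRFree.BadVanish
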